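import Literature.MathematicalPhysics.KineticTheory.IllnerPulvirentiCollisionDispersive
import HarnessLib

/-!
# Dispersive single-step estimate for the BBGKY collision operator on `ℝ^d` (CIP 1994 §4.5 (5.2)–(5.7), `σ > 0`)

Topic: MathematicalPhysics / KineticTheory. A brick of the BBGKY side of the convergence half of
the named fact `Literature.MathematicalPhysics.KineticTheory.illner_pulvirenti`
(Cercignani–Illner–Pulvirenti 1994 Thm 4.5.1, Step 3): the companion of
`IllnerPulvirentiCollisionDispersive` (which treats the Boltzmann hierarchy, `ε = 0`) for the
hard-sphere BBGKY collision operator `C_{s,s+1}` at a positive diameter `ε` (GST 2013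
(4.3.5)–(4.3.6); CIP (5.2): the added particle sits at `x_i + ε ω`).

At `ε > 0` the travelling Maxwellian is no longer an exact collision invariant of the gain
configuration — the two partners sit at `x_i` and `x_i + εω` — but in the PRE-collisional
parametrisation of the tree's `hsCollisionTerm` (gain kernel `(ω·(v - v_i))₊`) the defect has a
sign (`sum_norm_sq_sub_smul_gainConfig_ge`):
`I_τ(gain) ≥ I_τ(Z_s) + |x_i + εω - τ v|²` whenever `ω·(v - v_i) ≥ 0`, `τ, ε ≥ 0`
(the difference is `2ετ ω·(v - v_i)`). Hence the gain and loss integrands are dominated by the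
same majorant as at `ε = 0`, with the dispersion centre `Y = x_i + εω` depending on `ω` — which is
harmless, the velocity bound `integral_norm_add_mul_exp_mul_exp_dispersion_le` being uniform in
`Y` (this uniformity is (5.6) of CIP: `sup_z ∫∫ … dn dξ`):

* `abs_hsCollisionTerm_le_dispersive` — `|C^{i}_{s,s+1,ε} g (Z_s)| ≤ |S^{d-1}| A(τ) b^{-d/2} (b^{-1/2} + |v_i|) K e^{-β₀ I_τ(Z_s)} e^{-b H(Z_s)}`
  for `|g| ≤ K e^{-β₀ I_τ} e^{-b H}`, `0 < b ≤ b_max`, `β₀ > 0`, `τ, ε ≥ 0`;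
* `abs_bbgkyOp_le_dispersive` — the BBGKY operator `C_{s,s+1} = (N - s) ε^{d-1} ∑_i C^i` (tree
  normalisation): the same with the prefactor `N ε^{d-1}` — hypothesis `hop` of
  `abs_duhamelChain_le_dispersive_of_le` for the BBGKY hierarchy in `ℝ^d`, with
  `A(τ) = N ε^{d-1} |S^{d-1}| 2^d (2^d G₁ + b_max^{d/2} G_{β₀}) (1 + τ)^{-d}`.

Theorems only. (The transport hypothesis `htr` for the interacting flow is CIP Lemma 4.2.4,
`IsHardSphereTrajectory.sum_norm_sq_sub_smul_le_of_le` of `HardSphereDispersion`, valid along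
genuine trajectories, i.e. on the good set of a `HardSphereFlow`.)

## References

* C. Cercignani, R. Illner, M. Pulvirenti, *The Mathematical Theory of Dilute Gases*, Applied
  Mathematical Sciences 106, Springer (1994), §4.5, proof of Thm 4.5.1, Step 3, (5.2)–(5.7),
  pp. 88–90.
* I. Gallagher, L. Saint-Raymond, B. Texier, *From Newton to Boltzmann* (2013), (4.3.5)–(4.3.6).
-/

open MeasureTheory Metric Real Set Filter Topology
open scoped InnerProductSpace ENNReal Nat
open Literature.Analysis.FluidPDE

namespace Literature.MathematicalPhysics.KineticTheory

noncomputable section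

variable {d : Type*} [Fintype d] {s : ℕ}

/-! ## The dispersive weight in the collision configurations at `ε ≥ 0` -/

/-- In the loss configuration of `C^{i}_{s,s+1,ε}` on `ℝ^d` the added particle sits at
`x_i + εω` with velocity `v`: `I_τ(loss) = I_τ(Z_s) + |x_i + εω - τv|²`. [cite: CIP1994, §4.5 (5.2)–(5.3)] -/
theorem sum_norm_sq_sub_smul_lossConfig_eps (Zs : Config s d (EuclideanSpace ℝ d)) (i : Fin s)
    (ω v : EuclideanSpace ℝ d) (τ ε : ℝ) :
    ∑ j, ‖(lossConfig (Euclidean.geometry d) ε Zs i ω v j).1 -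
        τ • (lossConfig (Euclidean.geometry d) ε Zs i ω v j).2‖ ^ 2 =
      (∑ j, ‖(Zs j).1 - τ • (Zs j).2‖ ^ 2) + ‖(Zs i).1 + ε • ω - τ • v‖ ^ 2 := by
  rw [lossConfig, sum_norm_sq_sub_smul_appendParticle, Euclidean.geometry_translate]

/-- **The sign of the defect of the collision invariance at `ε > 0`** (pre-collisional
parametrisation): on the gain hemisphere `ω·(v - v_i) ≥ 0`, for `τ ≥ 0` and `ε ≥ 0`,
`I_τ(Z_s) + |x_i + εω - τv|² ≤ I_τ(gain)`, the difference being `2ετ ω·(v - v_i) ≥ 0`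
(pair invariance at the common point `x_i`, `norm_sq_sub_smul_collide_add`, and
`v* - v = ⟨v_i - v, ω⟩ ω`). [cite: CIP1994, §4.5 (5.3)–(5.4)] -/
theorem sum_norm_sq_sub_smul_gainConfig_ge (Zs : Config s d (EuclideanSpace ℝ d)) (i : Fin s)
    (ω : sphere (0 : EuclideanSpace ℝ d) 1) (v : EuclideanSpace ℝ d) {τ ε : ℝ} (hτ : 0 ≤ τ)
    (hε : 0 ≤ ε) (hgain : 0 ≤ ⟪(ω : EuclideanSpace ℝ d), v - (Zs i).2⟫_ℝ) :
    (∑ j, ‖(Zs j).1 - τ • (Zs j).2‖ ^ 2) + ‖(Zs i).1 + ε • (ω : EuclideanSpace ℝ d) - τ • v‖ ^ 2 ≤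
      ∑ j, ‖(gainConfig (Euclidean.geometry d) ε Zs i ω v j).1 -
        τ • (gainConfig (Euclidean.geometry d) ε Zs i ω v j).2‖ ^ 2 := by
  set x : EuclideanSpace ℝ d := (Zs i).1 with hx
  set vi : EuclideanSpace ℝ d := (Zs i).2 with hvi
  set vi' : EuclideanSpace ℝ d := (collide ω (vi, v)).1 with hvi'
  set v' : EuclideanSpace ℝ d := (collide ω (vi, v)).2 with hv'
  -- the configuration
  have hsum : ∑ j, ‖(gainConfig (Euclidean.geometry d) ε Zs i ω v j).1 -
        τ • (gainConfig (Euclidean.geometry d) ε Zs i ω v j).2‖ ^ 2 =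
      (∑ j, ‖(Zs j).1 - τ • (Zs j).2‖ ^ 2) - ‖x - τ • vi‖ ^ 2 + ‖x - τ • vi'‖ ^ 2 +
        ‖x + ε • (ω : EuclideanSpace ℝ d) - τ • v'‖ ^ 2 := by
    rw [gainConfig, sum_norm_sq_sub_smul_appendParticle, Euclidean.geometry_translate,
      reflectVel_eq_collide]
    have h := sum_norm_sq_sub_smul_update Zs i ((Zs i).1, (collide ω ((Zs i).2, v)).1) τ
    simp only at h
    simp only [hx, hvi, hvi', hv']
    linarith
  -- pair invariance at the common point `x`
  have hpair : ‖x - τ • vi'‖ ^ 2 + ‖x - τ • v'‖ ^ 2 = ‖x - τ • vi‖ ^ 2 + ‖x - τ • v‖ ^ 2 := by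
    have h := norm_sq_sub_smul_collide_add x τ ω (vi, v)
    simpa only [hvi', hv'] using h
  -- the two shifted squares
  have hexp : ∀ w : EuclideanSpace ℝ d, ‖x + ε • (ω : EuclideanSpace ℝ d) - τ • w‖ ^ 2 =
      ‖x - τ • w‖ ^ 2 + 2 * ε * ⟪(ω : EuclideanSpace ℝ d), x - τ • w⟫_ℝ + ε ^ 2 := fun w => by
    have e : x + ε • (ω : EuclideanSpace ℝ d) - τ • w = (x - τ • w) + ε • (ω : EuclideanSpace ℝ d) := by
      abel
    rw [e, norm_add_sq_real, inner_smul_right, norm_smul, mul_pow, Real.norm_eq_abs, sq_abs,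
      norm_eq_of_mem_sphere ω, real_inner_comm]
    ring
  -- `⟨ω, v' - v⟩ = ⟨v_i - v, ω⟩ = -⟨ω, v - v_i⟩`
  have hv'v : v' - v = ⟪vi - v, (ω : EuclideanSpace ℝ d)⟫_ℝ • (ω : EuclideanSpace ℝ d) := by
    simp only [hv', collide]
    abel
  have hinner : ⟪(ω : EuclideanSpace ℝ d), x - τ • v'⟫_ℝ - ⟪(ω : EuclideanSpace ℝ d), x - τ • v⟫_ℝ =
      τ * ⟪(ω : EuclideanSpace ℝ d), v - vi⟫_ℝ := by
    rw [← inner_sub_right]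
    have e : x - τ • v' - (x - τ • v) = -(τ • (v' - v)) := by
      rw [smul_sub]; abel
    rw [e, inner_neg_right, inner_smul_right, hv'v, inner_smul_right, real_inner_self_sphere,
      mul_one]
    have : ⟪vi - v, (ω : EuclideanSpace ℝ d)⟫_ℝ = -⟪(ω : EuclideanSpace ℝ d), v - vi⟫_ℝ := by
      rw [real_inner_comm, ← inner_neg_right, neg_sub]
    rw [this]
    ring
  rw [hsum, hexp v', hexp v]
  nlinarith [mul_nonneg (mul_nonneg hε hτ) hgain, hpair, hinner]

/-! ## The pointwise bound on the collision integrand at `ε ≥ 0` -/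

/-- Pointwise bound on the integrand of `C^{i}_{s,s+1,ε}` on `ℝ^d` under the dispersive bound
`|g(Z)| ≤ K e^{-β₀ I_τ(Z)} e^{-b H(Z)}` (`K ≥ 0`, `β₀ ≥ 0`, `τ, ε ≥ 0`):
`|(ω·(v - v_i))₊ g(gain)| + |(ω·(v - v_i))₋ g(loss)| ≤
K e^{-β₀ I_τ(Z_s)} e^{-b H(Z_s)} · (|v| + |v_i|) e^{-(b/2)|v|²} e^{-β₀|x_i + εω - τv|²}`
(CIP 1994 §4.5 (5.4)–(5.5), the gain weight by `sum_norm_sq_sub_smul_gainConfig_ge`).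
[cite: CIP1994, §4.5 (5.4)–(5.5)] -/
theorem abs_hsCollisionIntegrand_le_dispersive_eps (i : Fin s) {K b β₀ τ ε : ℝ} (hK : 0 ≤ K)
    (hβ₀ : 0 ≤ β₀) (hτ : 0 ≤ τ) (hε : 0 ≤ ε)
    {g : Config (s + 1) d (EuclideanSpace ℝ d) → ℝ}
    (hg : ∀ Z, |g Z| ≤ K * (exp (-β₀ * ∑ j, ‖(Z j).1 - τ • (Z j).2‖ ^ 2) *
      exp (-b * configEnergy Z)))
    (Zs : Config s d (EuclideanSpace ℝ d)) (ω : sphere (0 : EuclideanSpace ℝ d) 1)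
    (v : EuclideanSpace ℝ d) :
    |max ⟪(ω : EuclideanSpace ℝ d), v - (Zs i).2⟫_ℝ 0 *
          g (gainConfig (Euclidean.geometry d) ε Zs i ω v)| +
        |max (-⟪(ω : EuclideanSpace ℝ d), v - (Zs i).2⟫_ℝ) 0 *
          g (lossConfig (Euclidean.geometry d) ε Zs i ω v)| ≤
      (K * (exp (-β₀ * ∑ j, ‖(Zs j).1 - τ • (Zs j).2‖ ^ 2) * exp (-b * configEnergy Zs))) *
        ((‖v‖ + ‖(Zs i).2‖) * exp (-(b / 2) * ‖v‖ ^ 2) *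
          exp (-β₀ * ‖(Zs i).1 + ε • (ω : EuclideanSpace ℝ d) - τ • v‖ ^ 2)) := by
  set A := ⟪(ω : EuclideanSpace ℝ d), v - (Zs i).2⟫_ℝ with hA
  set I := ∑ j, ‖(Zs j).1 - τ • (Zs j).2‖ ^ 2 with hI
  set Y := ‖(Zs i).1 + ε • (ω : EuclideanSpace ℝ d) - τ • v‖ ^ 2 with hY
  set B := K * (exp (-β₀ * (I + Y)) * exp (-b * (configEnergy Zs + 2⁻¹ * ‖v‖ ^ 2))) with hB
  have hB0 : 0 ≤ B := by positivity
  -- loss: exact weight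
  have hloss : |g (lossConfig (Euclidean.geometry d) ε Zs i ω v)| ≤ B := by
    have h := hg (lossConfig (Euclidean.geometry d) ε Zs i ω v)
    rwa [configEnergy_lossConfig, sum_norm_sq_sub_smul_lossConfig_eps] at h
  -- gain: the weight is larger on the gain hemisphere
  have hgain : max A 0 * |g (gainConfig (Euclidean.geometry d) ε Zs i ω v)| ≤ max A 0 * B := by
    rcases le_or_gt A 0 with hA0 | hA0
    · rw [max_eq_right hA0, zero_mul, zero_mul]
    · refine mul_le_mul_of_nonneg_left ?_ (le_max_right _ _)
      have h := hg (gainConfig (Euclidean.geometry d) ε Zs i ω v)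
      rw [configEnergy_gainConfig] at h
      refine h.trans ?_
      have hge := sum_norm_sq_sub_smul_gainConfig_ge Zs i ω v hτ hε hA0.le
      simp only [hB]
      refine mul_le_mul_of_nonneg_left (mul_le_mul_of_nonneg_right (exp_le_exp.2 ?_) (exp_pos _).le) hK
      exact mul_le_mul_of_nonpos_left hge (by linarith)
  have hApos : 0 ≤ max A 0 := le_max_right _ _
  have hAneg : 0 ≤ max (-A) 0 := le_max_right _ _
  have hsum : max A 0 + max (-A) 0 = |A| := by
    rcases le_total 0 A with h | h
    · rw [max_eq_left h, max_eq_right (by linarith), abs_of_nonneg h, add_zero]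
    · rw [max_eq_right h, max_eq_left (by linarith), abs_of_nonpos h, zero_add]
  have hAle : |A| ≤ ‖v‖ + ‖(Zs i).2‖ := by
    calc |A| ≤ ‖(ω : EuclideanSpace ℝ d)‖ * ‖v - (Zs i).2‖ := abs_real_inner_le_norm _ _
      _ = ‖v - (Zs i).2‖ := by rw [norm_eq_of_mem_sphere ω, one_mul]
      _ ≤ ‖v‖ + ‖(Zs i).2‖ := norm_sub_le _ _
  have hBexp : B = (K * (exp (-β₀ * I) * exp (-b * configEnergy Zs))) *
      (exp (-(b / 2) * ‖v‖ ^ 2) * exp (-β₀ * Y)) := by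
    rw [hB, mul_add, exp_add, mul_add, exp_add]
    have : exp (-b * (2⁻¹ * ‖v‖ ^ 2)) = exp (-(b / 2) * ‖v‖ ^ 2) := by
      congr 1; ring
    rw [this]
    ring
  calc |max A 0 * g (gainConfig (Euclidean.geometry d) ε Zs i ω v)| +
        |max (-A) 0 * g (lossConfig (Euclidean.geometry d) ε Zs i ω v)|
      = max A 0 * |g (gainConfig (Euclidean.geometry d) ε Zs i ω v)| +
          max (-A) 0 * |g (lossConfig (Euclidean.geometry d) ε Zs i ω v)| := by
        rw [abs_mul, abs_mul, abs_of_nonneg hApos, abs_of_nonneg hAneg]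
    _ ≤ max A 0 * B + max (-A) 0 * B :=
        add_le_add hgain (mul_le_mul_of_nonneg_left hloss hAneg)
    _ = |A| * B := by rw [← add_mul, hsum]
    _ ≤ (‖v‖ + ‖(Zs i).2‖) * B := mul_le_mul_of_nonneg_right hAle hB0
    _ = _ := by rw [hBexp]; ring

/-! ## The single-step estimates at `ε ≥ 0` -/

/-- **Dispersive estimate for one elementary BBGKY collision term `C^{i}_{s,s+1,ε}` on `ℝ^d`**
(CIP 1994 §4.5 (5.2)–(5.7) at `σ > 0`): for `0 < b ≤ b_max`, `β₀ > 0`, `τ, ε ≥ 0`, `K ≥ 0` and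
`|g(Z)| ≤ K e^{-β₀ I_τ(Z)} e^{-b H(Z)}`,
`|hsCollisionTerm G ε s i g (Z_s)| ≤ |S^{d-1}| A(τ) b^{-d/2} (b^{-1/2} + |v_i|) K e^{-β₀ I_τ(Z_s)} e^{-b H(Z_s)}`,
`A(τ) = 2^d (2^d G₁ + b_max^{d/2} G_{β₀}) / (1 + τ)^d` — the same constant as at `ε = 0`, by the
uniformity in the dispersion centre of `integral_norm_add_mul_exp_mul_exp_dispersion_le`.
[cite: CIP1994, §4.5 (5.2)–(5.7)] -/
theorem abs_hsCollisionTerm_le_dispersive (i : Fin s) {K b bmax β₀ τ ε : ℝ} (hb : 0 < b)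
    (hbmax : b ≤ bmax) (hβ₀ : 0 < β₀) (hτ : 0 ≤ τ) (hε : 0 ≤ ε) (hK : 0 ≤ K)
    {g : Config (s + 1) d (EuclideanSpace ℝ d) → ℝ}
    (hg : ∀ Z, |g Z| ≤ K * (exp (-β₀ * ∑ j, ‖(Z j).1 - τ • (Z j).2‖ ^ 2) *
      exp (-b * configEnergy Z)))
    (Zs : Config s d (EuclideanSpace ℝ d)) :
    |hsCollisionTerm (Euclidean.geometry d) ε s i g Zs| ≤
      ((KineticTheory.sphereMeasure : Measure (sphere (0 : EuclideanSpace ℝ d) 1)).real univ *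
          (2 ^ Fintype.card d *
              (2 ^ Fintype.card d * (∫ w : EuclideanSpace ℝ d, exp (-‖w‖ ^ 2)) +
                sqrt bmax ^ Fintype.card d * ∫ w : EuclideanSpace ℝ d, exp (-β₀ * ‖w‖ ^ 2)) /
            (1 + τ) ^ Fintype.card d)) *
        (sqrt b ^ Fintype.card d)⁻¹ * ((sqrt b)⁻¹ + ‖(Zs i).2‖) *
        (K * (exp (-β₀ * ∑ j, ‖(Zs j).1 - τ • (Zs j).2‖ ^ 2) * exp (-b * configEnergy Zs))) := by
  haveI := Literature.Analysis.FluidPDE.isFiniteMeasure_sphereMeasure (E := EuclideanSpace ℝ d)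
  set D : ℕ := Fintype.card d with hD
  set Aτ : ℝ := 2 ^ D * (2 ^ D * (∫ w : EuclideanSpace ℝ d, exp (-‖w‖ ^ 2)) +
      sqrt bmax ^ D * ∫ w : EuclideanSpace ℝ d, exp (-β₀ * ‖w‖ ^ 2)) / (1 + τ) ^ D with hAτ
  set S : ℝ := (KineticTheory.sphereMeasure : Measure (sphere (0 : EuclideanSpace ℝ d) 1)).real univ
    with hS
  set M : ℝ := K * (exp (-β₀ * ∑ j, ‖(Zs j).1 - τ • (Zs j).2‖ ^ 2) * exp (-b * configEnergy Zs))
    with hM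
  have hM0 : 0 ≤ M := by positivity
  set L : ℝ := ((sqrt b)⁻¹ + ‖(Zs i).2‖) * (sqrt b ^ D)⁻¹ * Aτ with hL
  -- the `ω`-dependent majorants and their common bound
  set ψ : sphere (0 : EuclideanSpace ℝ d) 1 → EuclideanSpace ℝ d → ℝ := fun ω v =>
    (‖v‖ + ‖(Zs i).2‖) * exp (-(b / 2) * ‖v‖ ^ 2) *
      exp (-β₀ * ‖((Zs i).1 + ε • (ω : EuclideanSpace ℝ d)) - τ • v‖ ^ 2) with hψ
  have hψi : ∀ ω, Integrable (ψ ω) := fun ω =>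
    integrable_norm_add_mul_exp_mul_exp hb (norm_nonneg _) β₀ hβ₀.le _ τ
  have hψle : ∀ ω, ∫ v, ψ ω v ≤ L := fun ω =>
    integral_norm_add_mul_exp_mul_exp_dispersion_le hb hbmax hβ₀ (norm_nonneg _) _ hτ
  -- the inner (velocity) integrals
  have hinner : ∀ ω : sphere (0 : EuclideanSpace ℝ d) 1,
      ‖∫ v : EuclideanSpace ℝ d,
          (max ⟪(ω : EuclideanSpace ℝ d), v - (Zs i).2⟫_ℝ 0 *
              g (gainConfig (Euclidean.geometry d) ε Zs i ω v) -
            max (-⟪(ω : EuclideanSpace ℝ d), v - (Zs i).2⟫_ℝ) 0 *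
              g (lossConfig (Euclidean.geometry d) ε Zs i ω v))‖ ≤ M * L := fun ω => by
    have h1 : ‖∫ v : EuclideanSpace ℝ d,
          (max ⟪(ω : EuclideanSpace ℝ d), v - (Zs i).2⟫_ℝ 0 *
              g (gainConfig (Euclidean.geometry d) ε Zs i ω v) -
            max (-⟪(ω : EuclideanSpace ℝ d), v - (Zs i).2⟫_ℝ) 0 *
              g (lossConfig (Euclidean.geometry d) ε Zs i ω v))‖ ≤ M * ∫ v, ψ ω v :=
      (norm_integral_le_of_norm_le ((hψi ω).const_mul M) (Eventually.of_forall fun v => by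
        rw [Real.norm_eq_abs]
        have h := abs_hsCollisionIntegrand_le_dispersive_eps i hK hβ₀.le hτ hε hg Zs ω v
        refine (abs_sub _ _).trans (h.trans (le_of_eq ?_))
        simp only [hψ, hM])).trans_eq (integral_const_mul _ _)
    exact h1.trans (mul_le_mul_of_nonneg_left (hψle ω) hM0)
  -- the outer (impact direction) integral
  have hout : |hsCollisionTerm (Euclidean.geometry d) ε s i g Zs| ≤ (M * L) * S := by
    rw [← Real.norm_eq_abs]
    unfold Literature.Analysis.FluidPDE.hsCollisionTerm
    calc _ ≤ ∫ _ω, (M * L) ∂KineticTheory.sphereMeasure :=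
          norm_integral_le_of_norm_le (integrable_const _) (Eventually.of_forall hinner)
      _ = (M * L) * S := by rw [integral_const, smul_eq_mul, mul_comm]
  refine hout.trans (le_of_eq ?_)
  simp only [hL]
  ring

/-- **Dispersive single-step estimate for the BBGKY collision operator on `ℝ^d`**
`C_{s,s+1} = (N - s) ε^{d-1} ∑_i C^i_{s,s+1,ε}` (tree normalisation, GST (4.3.5)), `ε ≥ 0` —
hypothesis `hop` of `abs_duhamelChain_le_dispersive_of_le` for the BBGKY hierarchy with
`A(τ) = N ε^{d-1} |S^{d-1}| 2^d (2^d G₁ + b_max^{d/2} G_{β₀}) (1 + τ)^{-d}`: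
`|C_{s,s+1} g (Z_s)| ≤ A(τ) b^{-d/2} (s b^{-1/2} + ∑ |v_i|) K e^{-β₀ I_τ(Z_s)} e^{-b H(Z_s)}`
(CIP 1994 §4.5 (5.2)–(5.7); in the Boltzmann–Grad scaling `N ε^{d-1} = α`).
[cite: CIP1994, §4.5 (5.2)–(5.7)] -/
theorem abs_bbgkyOp_le_dispersive {ε : ℝ} (hε : 0 ≤ ε) (N s : ℕ) {K b bmax β₀ τ : ℝ}
    (hb : 0 < b) (hbmax : b ≤ bmax) (hβ₀ : 0 < β₀) (hτ : 0 ≤ τ) (hK : 0 ≤ K)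
    {g : Config (s + 1) d (EuclideanSpace ℝ d) → ℝ}
    (hg : ∀ Z, |g Z| ≤ K * (exp (-β₀ * ∑ j, ‖(Z j).1 - τ • (Z j).2‖ ^ 2) *
      exp (-b * configEnergy Z)))
    (Zs : Config s d (EuclideanSpace ℝ d)) :
    |bbgkyOp (Euclidean.geometry d) ε N s g Zs| ≤
      ((N * ε ^ (Fintype.card d - 1)) *
        ((KineticTheory.sphereMeasure : Measure (sphere (0 : EuclideanSpace ℝ d) 1)).real univ *
          (2 ^ Fintype.card d *
              (2 ^ Fintype.card d * (∫ w : EuclideanSpace ℝ d, exp (-‖w‖ ^ 2)) +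
                sqrt bmax ^ Fintype.card d * ∫ w : EuclideanSpace ℝ d, exp (-β₀ * ‖w‖ ^ 2)) /
            (1 + τ) ^ Fintype.card d))) *
        (sqrt b ^ Fintype.card d)⁻¹ * (s * (sqrt b)⁻¹ + ∑ i, ‖(Zs i).2‖) *
        (K * (exp (-β₀ * ∑ j, ‖(Zs j).1 - τ • (Zs j).2‖ ^ 2) * exp (-b * configEnergy Zs))) := by
  set C : ℝ := (KineticTheory.sphereMeasure : Measure (sphere (0 : EuclideanSpace ℝ d) 1)).real univ *
      (2 ^ Fintype.card d *
          (2 ^ Fintype.card d * (∫ w : EuclideanSpace ℝ d, exp (-‖w‖ ^ 2)) +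
            sqrt bmax ^ Fintype.card d * ∫ w : EuclideanSpace ℝ d, exp (-β₀ * ‖w‖ ^ 2)) /
        (1 + τ) ^ Fintype.card d) with hC
  have hpref : |((N - s : ℕ) : ℝ) * ε ^ (Fintype.card d - 1)| ≤ N * ε ^ (Fintype.card d - 1) := by
    rw [abs_of_nonneg (by positivity)]
    gcongr
    exact_mod_cast Nat.sub_le N s
  have hM0 : 0 ≤ K * (exp (-β₀ * ∑ j, ‖(Zs j).1 - τ • (Zs j).2‖ ^ 2) * exp (-b * configEnergy Zs)) := by
    positivity
  have hC0 : 0 ≤ C := by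
    have h1 : 0 ≤ ∫ w : EuclideanSpace ℝ d, exp (-‖w‖ ^ 2) := integral_nonneg fun w => (exp_pos _).le
    have h2 : 0 ≤ ∫ w : EuclideanSpace ℝ d, exp (-β₀ * ‖w‖ ^ 2) :=
      integral_nonneg fun w => (exp_pos _).le
    have h3 : (0 : ℝ) ≤ (KineticTheory.sphereMeasure : Measure (sphere (0 : EuclideanSpace ℝ d) 1)).real univ :=
      measureReal_nonneg
    have h4 : 0 < (1 + τ) ^ Fintype.card d := by positivity
    positivity
  unfold Literature.Analysis.FluidPDE.bbgkyOp Literature.Analysis.FluidPDE.bbgkyCollisionOp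
  calc |∑ i : Fin s, ((N - s : ℕ) : ℝ) * ε ^ (Fintype.card d - 1) *
          hsCollisionTerm (Euclidean.geometry d) ε s i g Zs|
      ≤ ∑ i : Fin s, |((N - s : ℕ) : ℝ) * ε ^ (Fintype.card d - 1) *
          hsCollisionTerm (Euclidean.geometry d) ε s i g Zs| := Finset.abs_sum_le_sum_abs _ _
    _ = ∑ i : Fin s, |((N - s : ℕ) : ℝ) * ε ^ (Fintype.card d - 1)| *
          |hsCollisionTerm (Euclidean.geometry d) ε s i g Zs| :=
        Finset.sum_congr rfl fun i _ => abs_mul _ _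
    _ ≤ ∑ i : Fin s, (N * ε ^ (Fintype.card d - 1)) *
          (C * (sqrt b ^ Fintype.card d)⁻¹ * ((sqrt b)⁻¹ + ‖(Zs i).2‖) *
            (K * (exp (-β₀ * ∑ j, ‖(Zs j).1 - τ • (Zs j).2‖ ^ 2) * exp (-b * configEnergy Zs)))) :=
        Finset.sum_le_sum fun i _ => mul_le_mul hpref
          (abs_hsCollisionTerm_le_dispersive i hb hbmax hβ₀ hτ hε hK hg Zs)
          (abs_nonneg _) (by positivity)
    _ = _ := by
        rw [← Finset.mul_sum, ← Finset.sum_mul, ← Finset.mul_sum, Finset.sum_add_distrib,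
          Finset.sum_const, Finset.card_univ, Fintype.card_fin, nsmul_eq_mul]
        simp only [hC]
        ring

end

end Literature.MathematicalPhysics.KineticTheory
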